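import Literature.Computability.Cryptography.InaccessibleEntropyUOWHFInverterSemantics
import HarnessLib

/-!
# One-way functions ⇒ UOWHF, machine layer X: the two probability bridges

Topic `Literature/Computability/Cryptography`; eighteenth file of the "one-way functions ⇒ universal one-way
hash functions" line (Haitner–Holenstein–Reingold–Vadhan–Wee 2020, Thm. 5.1 with Thm. 4.5). The combinatorial
analysis bounds, at one security parameter, a COUNT of designated collisions of one candidate by the quantity
`invSum` of the finder `advA0` (`CandData.tcr_prob_le`); the cryptographic statements are about the PROBABILITIES
`rtcrProb` (Def. 6.4.19) of the string family `HHRVW.family p f` and `invertProb` (Def. 2.2.1) of the inverting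
machine `inverter f q p A₀ A`. This file proves the two inequalities connecting them, by unfolding the
experiments into finite averages over coin strings and re-indexing along the codecs:

* **`sum_card_mul_invSum_le_invertProb`** — for every grid index `j`:
  `Σ_{r ≤ R} |𝒦| · invSum(advA0^{(j,r)}) ≤ 2^{n + |coins|} · Pr[inverter inverts f on U_n]`
  (the machine's coins decode to `(j', r', x, i, κ₀, …)`; restrict to `j' = j`, one level code per `r`,
  bound the machine's success by `advA0`'s (`inverts_of_advA0`), and remove the key fix-up by
  `card_mul_sum_fixup`);
* **`rtcrProb_le_sum_card`** — for every grid index `j`: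
  `Pr[restricted designated collision] ≤ Σ_{r ≤ R} #succ^{(j,r)} / (|𝔽₂^N| · |coins'| · |Ω|)`, where
  `#succ^{(j,r)}` is exactly the success count of the derived single-candidate adversary `(targetJR, advJR)`
  bounded by `CandData.tcr_prob_le` (a string collision is an abstract concatenation collision,
  `collision_abs_of_str`, then `card_concat_success_mul_le` and `card_chain_success_mul_le`).

All statements proved; no named facts.

## References

* I. Haitner, T. Holenstein, O. Reingold, S. Vadhan, H. Wee, *Inaccessible Entropy II: IE Functions and
  Universal One-Way Hashing*, Theory of Computing 16(8) (2020), Claim 4.6, Lemma 5.7, proof of Thm. 5.1, Step 5.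
* O. Goldreich, *Foundations of Cryptography II*, CUP 2004, Def. 6.4.19; *Foundations of Cryptography I*, CUP
  2001, Def. 2.2.1.
-/

namespace Literature.Computability.Cryptography

namespace HHRVW

open _root_.Computability Complexity Complexity.BitCodec AffineStr Sz Finset Polynomial

/-- Monotonicity of `0/1` indicators. [folklore] -/
theorem ite_le_ite_of_imp {P Q : Prop} [Decidable P] [Decidable Q] (h : P → Q) : (if P then (1 : ℝ) else 0) ≤ (if Q then 1 else 0) := by
  by_cases hP : P
  · rw [if_pos hP, if_pos (h hP)]
  · rw [if_neg hP]; split_ifs <;> norm_num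

section Bridge

variable {f : List Bool → List Bool} {q p : Polynomial ℕ} {A₀ : List Bool → List Bool} {A : RandAlg (List Bool) (List Bool)} {n : ℕ}

/-! ### The inverter side -/

/-- The level code of `r`. [folklore] -/
def rbOf (n : ℕ) (r : Fin (R n + 1)) : List.Vector Bool (aR n) := ⟨Complexity.natBits (aR n) r, Complexity.length_natBits _ _⟩

/-- Decoding the level code of `r` gives `r`. [folklore] -/
theorem rOfBits_rbOf (r : Fin (R n + 1)) : rOfBits n (rbOf n r).toList = r := by
  have h : bitsToNat (Complexity.natBits (aR n) r) = r :=
    Complexity.bitsToNat_natBits (lt_of_le_of_lt (Nat.le_of_lt_succ r.isLt) (R_lt n))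
  apply Fin.ext
  rw [rOfBits, rbOf]
  simp only [List.Vector.toList_mk, h, min_eq_left (Nat.le_of_lt_succ r.isLt)]

/-- `rbOf` is injective. [folklore] -/
theorem rbOf_injective : Function.Injective (rbOf n) := fun r r' h => by rw [← rOfBits_rbOf r, h, rOfBits_rbOf]

/-- Re-indexing the inverter's coins: challenge preimage and decoded coins ↦ (grid index, level bits), the data of
the inversion experiment `(x₀, x, i, κ₀)`, and the coins of the finder. [folklore] -/
def reix (n qn lo κA : ℕ) :
    Xv n × (CoinT n qn lo × List.Vector Bool κA) ≃
      (Fin (Jp1 n) × List.Vector Bool (aR n)) × ((Xv n × Xv n × Fin (M n) × Kv n) × CoinsA0 n qn lo κA) where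
  toFun := fun ⟨x₀, ⟨jv, rb, x, iv, κ₀, j₁, w, g₂, g₃, ρ, ysj, keys, lov⟩, ωv⟩ =>
    ((jv, rb), ((x₀, x, iv, κ₀), (j₁, w, (g₂, (g₃, ((ysj, (keys, (ρ, lov))), ωv))))))
  invFun := fun ⟨⟨jv, rb⟩, ⟨⟨x₀, x, iv, κ₀⟩, ⟨j₁, w, g₂, g₃, ⟨ysj, keys, ρ, lov⟩, ωv⟩⟩⟩ =>
    (x₀, ((jv, rb, x, iv, κ₀, j₁, w, g₂, g₃, ρ, ysj, keys, lov), ωv))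
  left_inv := fun ⟨_, ⟨_, _, _, _, _, _, _, _, _, _, _, _, _⟩, _⟩ => rfl
  right_inv := fun ⟨⟨_, _⟩, ⟨⟨_, _, _, _⟩, ⟨_, _, _, _, ⟨_, _, _, _⟩, _⟩⟩⟩ => rfl

/-- **The inverter bridge.** For every grid index `j`, summed over the chain levels,
`|𝒦| · invSum(advA0^{(j,r)}) ≤ 2^{n + |coins|} · Pr_{x₀ ← U_n}[inverter inverts f(x₀)]`.
[cite: HaitnerEtAl2020, Claim 4.6 with proof of Thm. 5.1, Step 5] -/
theorem sum_card_mul_invSum_le_invertProb (hf : IsLengthPreserving f) (hK : K n ≤ p.eval n) (j : Fin (Jp1 n)) :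
    ∑ r : Fin (R n + 1), (Fintype.card (Kv n) : ℝ) *
        invSum (cand n j f).f (cand n j f).hp (M n)
          ((cand n j f).advA0 (targetJR f n (q.eval n) (p.eval n - K n) A₀ j r)
            (advJR f n (q.eval n) (p.eval n - K n) (A.coinLen (lenA q p n)) A j r)) ≤
      2 ^ (n + (Inv.pre n q p + A.coinLen (lenA q p n))) * invertProb f (inverter f q p A₀ A) n := by
  classical
  set κA := A.coinLen (lenA q p n) with hκA
  set lo := p.eval n - K n with hlodef
  set qn := q.eval n with hqn
  have hlo : K n + lo = p.eval n := by omega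
  set CC := (coinCodec n qn lo).prod (BitCodec.vector κA) with hCC
  have hCClen : CC.len = Inv.pre n q p + κA := by rw [hCC, prod_len, coinCodec_len hlo hqn]; rfl
  -- the success indicators
  let IM : Xv n → List Bool → ℝ := fun x₀ c =>
    if f ((inverter f q p A₀ A).run (boolPair (unaryEncodeNat n) (f x₀.toList)) c) = f x₀.toList then 1 else 0
  let IA : (Fin (Jp1 n) × List.Vector Bool (aR n)) → ((Xv n × Xv n × Fin (M n) × Kv n) × CoinsA0 n qn lo κA) → ℝ :=
    fun jr d => if f ((cand n jr.1 f).advA0 (targetJR f n qn lo A₀ jr.1 (rOfBits n jr.2.toList)) (advJR f n qn lo κA A jr.1 (rOfBits n jr.2.toList))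
      d.1.2.1 (κfix n f d.1.1 d.1.2.1 d.1.2.2.2 d.1.2.2.1) d.1.2.2.1 d.2).toList = f d.1.1.toList then 1 else 0
  -- Step 1: the inversion probability as a double sum over `x₀` and the coins
  have hpr : ∀ x₀ : Xv n, (inverter f q p A₀ A).pr id (boolPair (unaryEncodeNat n) (f x₀.toList)) {z | f z = f x₀.toList} =
      (∑ c : List.Vector Bool CC.len, IM x₀ c.toList) / 2 ^ CC.len := fun x₀ => by
    rw [LenPres.pr_eq_uniformAvg_ite _ _ _ _ (k := CC.len) ?_, uniformAvg]
    · rfl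
    · show Inv.pre (nOfLen (boolPair (unaryEncodeNat n) (f x₀.toList)).length) q p +
          A.coinLen (lenA q p (nOfLen (boolPair (unaryEncodeNat n) (f x₀.toList)).length)) = CC.len
      rw [nOfLen_eq n (by rw [hf, List.Vector.toList_length]), hCClen]
  have h1 : (2 : ℝ) ^ (n + CC.len) * invertProb f (inverter f q p A₀ A) n = ∑ x₀ : Xv n, ∑ c : List.Vector Bool CC.len, IM x₀ c.toList := by
    rw [invertProb, uniformAvg, Finset.sum_congr rfl fun x₀ _ => hpr x₀, ← Finset.sum_div, pow_add]
    field_simp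
  -- Step 2: the machine succeeds whenever `advA0` does
  have h2 : ∑ x₀ : Xv n, ∑ c : List.Vector Bool CC.len, IM x₀ c.toList ≥
      ∑ x₀ : Xv n, ∑ τω : CoinT n qn lo × List.Vector Bool κA, IA (reix n qn lo κA (x₀, τω)).1 (reix n qn lo κA (x₀, τω)).2 := by
    refine Finset.sum_le_sum fun x₀ _ => ?_
    rw [CC.sum_vector_eq (IM x₀)]
    refine Finset.sum_le_sum fun τω _ => ?_
    rcases τω with ⟨⟨jv, rb, x, iv, κ₀, j₁, w, g₂, g₃, ρ, ysj, keys, lov⟩, ωv⟩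
    refine ite_le_ite_of_imp fun h => ?_
    have hlen : Inv.pre n q p ≤ ((coinCodec n qn lo).enc (jv, rb, x, iv, κ₀, j₁, w, g₂, g₃, ρ, ysj, keys, lov) ++ ωv.toList).length := by
      rw [List.length_append, (coinCodec n qn lo).length_enc, coinCodec_len hlo hqn]; exact Nat.le_add_right _ _
    rw [hCC, prod_enc, vector_enc, inverter_run (by rw [hf, List.Vector.toList_length]) hlen hf hK]
    exact inverts_of_advA0 hf hlo (jv, rb, x, iv, κ₀, j₁, w, g₂, g₃, ρ, ysj, keys, lov) ωv x₀ h
  -- Step 3: re-index, keep only `j`, one level code per level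
  have h3 : ∑ x₀ : Xv n, ∑ τω : CoinT n qn lo × List.Vector Bool κA, IA (reix n qn lo κA (x₀, τω)).1 (reix n qn lo κA (x₀, τω)).2 ≥
      ∑ r : Fin (R n + 1), ∑ d : (Xv n × Xv n × Fin (M n) × Kv n) × CoinsA0 n qn lo κA, IA (j, rbOf n r) d := by
    have hnn : ∀ jr d, 0 ≤ IA jr d := fun jr d => by simp only [IA]; split_ifs <;> norm_num
    rw [← Fintype.sum_prod_type', Fintype.sum_equiv (reix n qn lo κA) _ (fun z => IA z.1 z.2) (fun _ => rfl), Fintype.sum_prod_type,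
      Fintype.sum_prod_type]
    calc ∑ r : Fin (R n + 1), ∑ d, IA (j, rbOf n r) d
        = ∑ rb ∈ (univ : Finset (Fin (R n + 1))).image (rbOf n), ∑ d, IA (j, rb) d := by
          rw [Finset.sum_image fun r _ r' _ h => rbOf_injective h]
      _ ≤ ∑ rb : List.Vector Bool (aR n), ∑ d, IA (j, rb) d :=
          Finset.sum_le_sum_of_subset_of_nonneg (Finset.subset_univ _) fun rb _ _ => Finset.sum_nonneg fun d _ => hnn _ _
      _ ≤ ∑ jv : Fin (Jp1 n), ∑ rb : List.Vector Bool (aR n), ∑ d, IA (jv, rb) d :=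
          Finset.single_le_sum (f := fun jv => ∑ rb : List.Vector Bool (aR n), ∑ d, IA (jv, rb) d)
            (fun jv _ => Finset.sum_nonneg fun rb _ => Finset.sum_nonneg fun d _ => hnn _ _) (Finset.mem_univ j)
  -- Step 4: remove the fix-up, level by level
  have h4 : ∀ r : Fin (R n + 1), (Fintype.card (Kv n) : ℝ) *
      invSum (cand n j f).f (cand n j f).hp (M n) ((cand n j f).advA0 (targetJR f n qn lo A₀ j r) (advJR f n qn lo κA A j r)) ≤
      ∑ d : (Xv n × Xv n × Fin (M n) × Kv n) × CoinsA0 n qn lo κA, IA (j, rbOf n r) d := by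
    intro r
    rw [invSum, Finset.mul_sum, Fintype.sum_prod_type, Fintype.sum_prod_type]
    refine Finset.sum_le_sum fun x₀ _ => ?_
    rw [Finset.mul_sum, Fintype.sum_prod_type]
    refine Finset.sum_le_sum fun x _ => ?_
    rw [Finset.mul_sum, Fintype.sum_prod_type]
    refine Finset.sum_le_sum fun iv _ => ?_
    -- the fix-up identity for `(x₀, x, iv)`
    set G : Kv n → ℝ := fun κ => ∑ c : CoinsA0 n qn lo κA,
      if f ((cand n j f).advA0 (targetJR f n qn lo A₀ j r) (advJR f n qn lo κA A j r) x κ iv c).toList = f x₀.toList then 1 else 0 with hG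
    have hfix := card_mul_sum_fixup (j := (j : ℕ)) hf x₀ x iv G
    have hGnn : ∀ κ, 0 ≤ G κ := fun κ => Finset.sum_nonneg fun c _ => by split_ifs <;> norm_num
    -- rewrite the right-hand side through `G`
    have hR : ∑ κ₀ : Kv n, ∑ c : CoinsA0 n qn lo κA, IA (j, rbOf n r) ((x₀, x, iv, κ₀), c) = ∑ κ₀ : Kv n, G (κfix n f x₀ x κ₀ iv) := by
      refine Finset.sum_congr rfl fun κ₀ _ => ?_
      simp only [IA, hG, rOfBits_rbOf]
    rw [hR]
    -- the left-hand side is `|𝒦| · (Σ_{plantKeys} G)/|plantKeys|`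
    have hL : (Fintype.card (Kv n) : ℝ) * ((∑ κ ∈ plantKeys (cand n j f).f (cand n j f).hp x₀ x iv,
        ∑ c : CoinsA0 n qn lo κA, if (cand n j f).f ((cand n j f).advA0 (targetJR f n qn lo A₀ j r) (advJR f n qn lo κA A j r) x κ iv c) =
          (cand n j f).f x₀ then (1 : ℝ) else 0) / ((plantKeys (cand n j f).f (cand n j f).hp x₀ x iv).card : ℝ)) =
        (Fintype.card (Kv n) : ℝ) * ((∑ κ ∈ plantKeys (cand n j f).f (cand n j f).hp x₀ x iv, G κ) /
          ((plantKeys (cand n j f).f (cand n j f).hp x₀ x iv).card : ℝ)) := rfl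
    rw [hL]
    by_cases hPK : (plantKeys (cand n j f).f (cand n j f).hp x₀ x iv).card = 0
    · rw [hPK, Nat.cast_zero, div_zero, mul_zero]; exact Finset.sum_nonneg fun κ₀ _ => hGnn _
    · have hpos : (0 : ℝ) < (plantKeys (cand n j f).f (cand n j f).hp x₀ x iv).card := by exact_mod_cast Nat.pos_of_ne_zero hPK
      have key : ∀ S : ℝ, ((plantKeys (cand n j f).f (cand n j f).hp x₀ x iv).card : ℝ) * S /
          ((plantKeys (cand n j f).f (cand n j f).hp x₀ x iv).card : ℝ) = S := fun S => by field_simp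
      rw [mul_div_assoc', ← hfix, key]
      -- `κfix` unfolds to the parsed fix-up
      exact le_rfl
  -- assemble
  calc ∑ r : Fin (R n + 1), (Fintype.card (Kv n) : ℝ) *
        invSum (cand n j f).f (cand n j f).hp (M n) ((cand n j f).advA0 (targetJR f n qn lo A₀ j r) (advJR f n qn lo κA A j r))
      ≤ ∑ r : Fin (R n + 1), ∑ d, IA (j, rbOf n r) d := Finset.sum_le_sum fun r _ => h4 r
    _ ≤ _ := h3
    _ ≤ _ := h2
    _ = (2 : ℝ) ^ (n + CC.len) * invertProb f (inverter f q p A₀ A) n := h1.symm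
    _ = _ := by rw [hCClen]

/-! ### The UOWHF side -/

/-- Counting through an equivalence: `#{a | P a} = #{b | P (e.symm b)}`. [folklore] -/
theorem card_filter_equiv {α β : Type*} [Fintype α] [Fintype β] (e : α ≃ β) (P : α → Prop) [DecidablePred P] :
    ((univ : Finset α).filter P).card = ((univ : Finset β).filter fun b => P (e.symm b)).card := by
  rw [← Finset.card_map e.toEmbedding]
  congr 1
  ext b
  simp only [Finset.mem_map_equiv, Finset.mem_filter, Finset.mem_univ, true_and]

/-- The target of the abstract concatenation adversary: the parse of `A₀(ρ)` (leftover coins ignored).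
[cite: HaitnerEtAl2020, proof of Thm. 5.1, Step 5] -/
def x0C (n qn lo : ℕ) (A₀ : List Bool → List Bool) (c : List.Vector Bool qn × List.Vector Bool lo) : Dv n × (Fin (R n) → Bool) :=
  targetAbs n qn A₀ c.1

/-- The chained components as a `J+1`-indexed family. [cite: HaitnerEtAl2020, proof of Thm. 5.1, Step 5] -/
noncomputable def GcF (f : List Bool → List Bool) (n : ℕ) :
    Fin (Jp1 n) → (Fin (R n + 1) → Dv n) → (Dv n × (Fin (R n) → Bool)) → (G3v n × R3v n) := fun j => chainAbs f n j

/-- **The UOWHF bridge.** For every grid index `j`, the probability of a restricted designated collision of the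
string family is at most the sum over the chain levels of the normalised success counts of the derived
single-candidate adversaries `(targetJR j r, advJR j r)` — the left-hand side of `CandData.tcr_prob_le`.
[cite: HaitnerEtAl2020, proof of Thm. 5.1, Step 5 with Lemma 5.7; Goldreich 2004, Def. 6.4.19] -/
theorem rtcrProb_le_sum_card (hf : IsLengthPreserving f) (hK : K n ≤ p.eval n) (j : Fin (Jp1 n)) :
    (family p f).rtcrProb (dLen p) (fun m => q.eval m) A₀ A n ≤
      ∑ r : Fin (R n + 1),
        (((univ : Finset (Dv n × CoinsJR n (q.eval n) (p.eval n - K n) × List.Vector Bool (A.coinLen (lenA q p n)))).filter fun z =>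
            advJR f n (q.eval n) (p.eval n - K n) (A.coinLen (lenA q p n)) A j r z.1 z.2.1 z.2.2 ≠
                targetJR f n (q.eval n) (p.eval n - K n) A₀ j r z.2.1 ∧
              (cand n j f).fam z.1 (advJR f n (q.eval n) (p.eval n - K n) (A.coinLen (lenA q p n)) A j r z.1 z.2.1 z.2.2) =
                (cand n j f).fam z.1 (targetJR f n (q.eval n) (p.eval n - K n) A₀ j r z.2.1)).card : ℝ) /
          ((Fintype.card (Dv n) : ℝ) * Fintype.card (CoinsJR n (q.eval n) (p.eval n - K n)) *
            Fintype.card (List.Vector Bool (A.coinLen (lenA q p n)))) := by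
  classical
  -- names for the sizes
  set κA := A.coinLen (lenA q p n) with hκA
  set lo := p.eval n - K n with hlodef
  set qn := q.eval n with hqn
  have hlo : K n + lo = p.eval n := by rw [hlodef]; omega
  let KC := (keysCodec n).prod (BitCodec.vector lo)
  have hKClen : KC.len = p.eval n := by show (keysCodec n).len + lo = p.eval n; rw [keysCodec_len]; exact hlo
  -- abbreviations for the types
  let Keys := Fin (Jp1 n) → Fin (R n + 1) → Dv n
  let Yv := Fin (R n + 1) → Dv n
  -- the abstract two-stage adversary of the concatenation: `(x0C, advAbs)` against `concatFam (GcF f n)`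
  let E : Keys × (List.Vector Bool qn × List.Vector Bool lo) × (List.Vector Bool κA) → Prop := fun z => advAbs n qn lo κA A z.1 z.2.1 z.2.2 ≠ x0C n qn lo A₀ z.2.1 ∧
    concatFam (GcF f n) z.1 (advAbs n qn lo κA A z.1 z.2.1 z.2.2) = concatFam (GcF f n) z.1 (x0C n qn lo A₀ z.2.1)
  -- Step 1: the probability as a normalised count over `(ρ, ys, ω)`
  let IS : List.Vector Bool qn → List.Vector Bool KC.len → (List.Vector Bool κA) → ℝ := fun ρ ys ω =>
    if (family p f).IsRestrictedCollision (dLen p)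
        ((family p f).index.run n ys.toList, A₀ ρ.toList,
          A.run (boolPair (unaryEncodeNat n) (boolPair ((family p f).index.run n ys.toList) ρ.toList)) ω.toList) then 1 else 0
  have hlenA : ∀ (ρ : List.Vector Bool qn) (ys : List.Vector Bool KC.len),
      (boolPair (unaryEncodeNat n) (boolPair ((family p f).index.run n ys.toList) ρ.toList)).length = lenA q p n := by
    intro ρ ys
    simp only [lenA, length_boolPair, family_index_run, ones, List.length_append, List.length_replicate, List.length_cons,
      List.Vector.toList_length, hKClen, unaryEncodeNat_eq_replicate]; ring
  have hmid : (family p f).index.coinLen (unaryEncodeNat n).length = KC.len := by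
    rw [family_index_coinLen, unaryEncodeNat_eq_replicate, List.length_replicate, hKClen]
  have hin : ∀ (ρ : List.Vector Bool qn) (ys : List.Vector Bool KC.len),
      uniformAvg (A.coinLen (boolPair (unaryEncodeNat n) (boolPair ((family p f).index.run n ys.toList) ρ.toList)).length)
        (fun rA => if (family p f).IsRestrictedCollision (dLen p)
          ((family p f).index.run n ys.toList, A₀ ρ.toList, A.run (boolPair (unaryEncodeNat n) (boolPair ((family p f).index.run n ys.toList) ρ.toList)) rA)
          then (1 : ℝ) else 0) = (∑ ω : (List.Vector Bool κA), IS ρ ys ω) / 2 ^ κA := by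
    intro ρ ys; rw [hlenA ρ ys, uniformAvg]
  have h1 : (family p f).rtcrProb (dLen p) (fun m => q.eval m) A₀ A n =
      (∑ ρ : List.Vector Bool qn, ∑ ys : List.Vector Bool KC.len, ∑ ω : (List.Vector Bool κA), IS ρ ys ω) / (2 ^ qn * 2 ^ KC.len * 2 ^ κA) := by
    rw [HashCollection.rtcrProb_eq_uniformAvg, hmid, uniformAvg]
    have hρ : ∀ ρ : List.Vector Bool qn, uniformAvg KC.len (fun rI => uniformAvg
        (A.coinLen (boolPair (unaryEncodeNat n) (boolPair ((family p f).index.run n rI) ρ.toList)).length)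
        (fun rA => if (family p f).IsRestrictedCollision (dLen p)
          ((family p f).index.run n rI, A₀ ρ.toList, A.run (boolPair (unaryEncodeNat n) (boolPair ((family p f).index.run n rI) ρ.toList)) rA)
          then (1 : ℝ) else 0)) = (∑ ys : List.Vector Bool KC.len, (∑ ω : (List.Vector Bool κA), IS ρ ys ω) / 2 ^ κA) / 2 ^ KC.len := by
      intro ρ
      rw [uniformAvg, Finset.sum_congr rfl fun ys _ => hin ρ ys]
    rw [Finset.sum_congr rfl fun ρ _ => hρ ρ]
    simp only [← Finset.sum_div]
    rw [div_div, div_div]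
    refine congrArg₂ (· / ·) rfl ?_
    ring
  -- Step 2: a restricted collision is an abstract concatenation collision
  have h2 : ∀ (ρ : List.Vector Bool qn) (ys : List.Vector Bool KC.len) (ω : (List.Vector Bool κA)), IS ρ ys ω ≤
      (if E ((KC.dec ys.toList).1, (ρ, (KC.dec ys.toList).2), ω) then 1 else 0) := by
    intro ρ ys ω
    refine ite_le_ite_of_imp fun hc => ?_
    have hsplit : KC.enc (KC.dec ys.toList) = ys.toList := KC.enc_dec ys.toList (List.Vector.toList_length ys)
    have hys : ys.toList = (keysCodec n).enc (KC.dec ys.toList).1 ++ ((KC.dec ys.toList).2).toList := hsplit.symm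
    have hrun : (family p f).index.run n ys.toList = indexStr n (KC.dec ys.toList).1 ((KC.dec ys.toList).2).toList := by
      rw [family_index_run, indexStr, ← hys]
    simp only [HashCollection.IsRestrictedCollision] at hc
    obtain ⟨hl0, hl1, hcoll, hne⟩ := hc
    have hsl : ((family p f).index.run n ys.toList).length = LenPres.M p n := by
      rw [family_index_run, List.length_append, List.length_cons, List.Vector.toList_length, hKClen, LenPres.M]
      simp only [ones, List.length_replicate]; ring
    have hd : dLen p ((family p f).index.run n ys.toList).length = d n := by
      rw [hsl, dLen, LenPres.nOf_eq le_rfl (LenPres.M_strictMono (Nat.lt_succ_self n))]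
    rw [hd] at hl0 hl1
    rw [hrun] at hcoll hne hl1
    have key := collision_abs_of_str hf hK (KC.dec ys.toList).1 (l := ((KC.dec ys.toList).2).toList)
      (by rw [List.Vector.toList_length]; exact hlo) hl0 hl1 hcoll hne
    simp only [E, x0C]
    rw [advAbs, targetAbs, fitLen_of_length_eq hl1, fitLen_of_length_eq hl0]
    unfold GcF
    exact key
  -- Step 3: the count `C₀` of abstract concatenation successes
  let C₀ := ((univ : Finset (Keys × (List.Vector Bool qn × List.Vector Bool lo) × (List.Vector Bool κA))).filter E).card
  have h3 : ∑ ρ : List.Vector Bool qn, ∑ ys : List.Vector Bool KC.len, ∑ ω : (List.Vector Bool κA), IS ρ ys ω ≤ C₀ := by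
    calc ∑ ρ : List.Vector Bool qn, ∑ ys : List.Vector Bool KC.len, ∑ ω : (List.Vector Bool κA), IS ρ ys ω
        ≤ ∑ ρ : List.Vector Bool qn, ∑ ys : List.Vector Bool KC.len, ∑ ω : (List.Vector Bool κA), (if E ((KC.dec ys.toList).1, (ρ, (KC.dec ys.toList).2), ω) then (1 : ℝ) else 0) :=
          Finset.sum_le_sum fun ρ _ => Finset.sum_le_sum fun ys _ => Finset.sum_le_sum fun ω _ => h2 ρ ys ω
      _ = ∑ ρ : List.Vector Bool qn, ∑ kl : Keys × List.Vector Bool lo, ∑ ω : (List.Vector Bool κA), (if E (kl.1, (ρ, kl.2), ω) then (1 : ℝ) else 0) := by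
          refine Finset.sum_congr rfl fun ρ _ => ?_
          rw [KC.sum_vector_eq (fun l => ∑ ω : (List.Vector Bool κA), if E ((KC.dec l).1, (ρ, (KC.dec l).2), ω) then (1 : ℝ) else 0)]
          refine Finset.sum_congr rfl fun kl _ => ?_
          rw [KC.dec_enc]
      _ = ∑ z : Keys × (List.Vector Bool qn × List.Vector Bool lo) × (List.Vector Bool κA), (if E z then (1 : ℝ) else 0) := by
          simp only [Fintype.sum_prod_type]
          rw [Finset.sum_comm]
      _ = C₀ := by rw [Finset.natCast_card_filter]
  -- Step 4: planting at component `j` (`× |Y|`), then at a level (`× |𝔽₂^N|`, summed over the levels)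
  have h4 : C₀ * Fintype.card Yv ≤ ((univ : Finset (Yv × Keys × (List.Vector Bool qn × List.Vector Bool lo) × (List.Vector Bool κA))).filter fun z =>
      advAbs n qn lo κA A (Function.update z.2.1 j z.1) z.2.2.1 z.2.2.2 ≠ x0C n qn lo A₀ z.2.2.1 ∧
        GcF f n j z.1 (advAbs n qn lo κA A (Function.update z.2.1 j z.1) z.2.2.1 z.2.2.2) = GcF f n j z.1 (x0C n qn lo A₀ z.2.2.1)).card :=
    card_concat_success_mul_le (GcF f n) (x0C n qn lo A₀) (advAbs n qn lo κA A) j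
  -- the planted adversary is `(targetJ, advJ j)` against the chain `j`
  let eC : Yv × Keys × (List.Vector Bool qn × List.Vector Bool lo) × (List.Vector Bool κA) ≃ Yv × CoinsC n qn lo × (List.Vector Bool κA) := Equiv.prodCongr (Equiv.refl _) (Equiv.prodAssoc _ _ _).symm
  have h5 : ((univ : Finset (Yv × Keys × (List.Vector Bool qn × List.Vector Bool lo) × (List.Vector Bool κA))).filter fun z =>
      advAbs n qn lo κA A (Function.update z.2.1 j z.1) z.2.2.1 z.2.2.2 ≠ x0C n qn lo A₀ z.2.2.1 ∧
        GcF f n j z.1 (advAbs n qn lo κA A (Function.update z.2.1 j z.1) z.2.2.1 z.2.2.2) = GcF f n j z.1 (x0C n qn lo A₀ z.2.2.1)).card =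
      ((univ : Finset (Yv × CoinsC n qn lo × (List.Vector Bool κA))).filter fun z =>
        advJ n qn lo κA A j z.1 z.2.1 z.2.2 ≠ targetJ n qn lo A₀ z.2.1 ∧
          chainOut (famO f n j) (pack n) (R n) z.1 (advJ n qn lo κA A j z.1 z.2.1 z.2.2) =
            chainOut (famO f n j) (pack n) (R n) z.1 (targetJ n qn lo A₀ z.2.1)).card := by
    rw [card_filter_equiv eC]
    rfl
  have h6 := card_chain_success_mul_le (famO f n j) (pack n) (R n) (pack_injective n) (targetJ n qn lo A₀) (advJ n qn lo κA A j)
  let eR : Dv n × Yv × CoinsC n qn lo × (List.Vector Bool κA) ≃ Dv n × CoinsJR n qn lo × (List.Vector Bool κA) := Equiv.prodCongr (Equiv.refl _) (Equiv.prodAssoc _ _ _).symm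
  have h7 : ∀ r : Fin (R n + 1), ((univ : Finset (Dv n × Yv × CoinsC n qn lo × (List.Vector Bool κA))).filter fun z =>
      chainState (famO f n j) (pack n) (R n) (Function.update z.2.1 r z.1)
          (advJ n qn lo κA A j (Function.update z.2.1 r z.1) z.2.2.1 z.2.2.2).1
          (advJ n qn lo κA A j (Function.update z.2.1 r z.1) z.2.2.1 z.2.2.2).2 r ≠
        chainState (famO f n j) (pack n) (R n) z.2.1 (targetJ n qn lo A₀ z.2.2.1).1 (targetJ n qn lo A₀ z.2.2.1).2 r ∧
      famO f n j z.1 (chainState (famO f n j) (pack n) (R n) (Function.update z.2.1 r z.1)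
          (advJ n qn lo κA A j (Function.update z.2.1 r z.1) z.2.2.1 z.2.2.2).1
          (advJ n qn lo κA A j (Function.update z.2.1 r z.1) z.2.2.1 z.2.2.2).2 r) =
        famO f n j z.1 (chainState (famO f n j) (pack n) (R n) z.2.1 (targetJ n qn lo A₀ z.2.2.1).1 (targetJ n qn lo A₀ z.2.2.1).2 r)).card =
      ((univ : Finset (Dv n × CoinsJR n qn lo × (List.Vector Bool κA))).filter fun z =>
        advJR f n qn lo κA A j r z.1 z.2.1 z.2.2 ≠ targetJR f n qn lo A₀ j r z.2.1 ∧
          (cand n j f).fam z.1 (advJR f n qn lo κA A j r z.1 z.2.1 z.2.2) = (cand n j f).fam z.1 (targetJR f n qn lo A₀ j r z.2.1)).card := by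
    intro r
    rw [card_filter_equiv eR]
    rfl
  -- Step 5: assemble with the cardinalities
  have hY0 : (0 : ℝ) < Fintype.card Yv := by exact_mod_cast Fintype.card_pos
  have hD0 : (0 : ℝ) < Fintype.card (Dv n) := by exact_mod_cast Fintype.card_pos
  have hcardC : (Fintype.card (CoinsJR n qn lo) : ℝ) = Fintype.card Yv * (Fintype.card Keys * Fintype.card (List.Vector Bool qn × List.Vector Bool lo)) := by
    show (Fintype.card (Yv × (Keys × (List.Vector Bool qn × List.Vector Bool lo))) : ℝ) = _
    rw [Fintype.card_prod, Fintype.card_prod]; push_cast; ring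
  have hZ : (2 : ℝ) ^ qn * 2 ^ KC.len * 2 ^ κA =
      Fintype.card Keys * Fintype.card (List.Vector Bool qn × List.Vector Bool lo) * Fintype.card (List.Vector Bool κA) := by
    have hK' : Fintype.card (Keys × List.Vector Bool lo) = 2 ^ KC.len := KC.card_eq
    rw [Fintype.card_prod, card_vector, Fintype.card_bool] at hK'
    have hK'' : (Fintype.card Keys : ℝ) * 2 ^ lo = 2 ^ KC.len := by exact_mod_cast hK'
    rw [Fintype.card_prod, card_vector, card_vector, card_vector, Fintype.card_bool]
    push_cast
    rw [← hK'']; ring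
  -- the chain of inequalities, in `ℝ`
  have h4R : (C₀ : ℝ) ≤ ((univ : Finset (Yv × CoinsC n qn lo × (List.Vector Bool κA))).filter fun z =>
        advJ n qn lo κA A j z.1 z.2.1 z.2.2 ≠ targetJ n qn lo A₀ z.2.1 ∧
          chainOut (famO f n j) (pack n) (R n) z.1 (advJ n qn lo κA A j z.1 z.2.1 z.2.2) =
            chainOut (famO f n j) (pack n) (R n) z.1 (targetJ n qn lo A₀ z.2.1)).card / (Fintype.card Yv : ℝ) := by
    rw [le_div_iff₀ hY0, ← h5]; exact_mod_cast h4
  have h6R : ((((univ : Finset (Yv × CoinsC n qn lo × (List.Vector Bool κA))).filter fun z =>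
        advJ n qn lo κA A j z.1 z.2.1 z.2.2 ≠ targetJ n qn lo A₀ z.2.1 ∧
          chainOut (famO f n j) (pack n) (R n) z.1 (advJ n qn lo κA A j z.1 z.2.1 z.2.2) =
            chainOut (famO f n j) (pack n) (R n) z.1 (targetJ n qn lo A₀ z.2.1)).card : ℕ) : ℝ) ≤
      (∑ r : Fin (R n + 1), (((univ : Finset (Dv n × CoinsJR n qn lo × (List.Vector Bool κA))).filter fun z =>
        advJR f n qn lo κA A j r z.1 z.2.1 z.2.2 ≠ targetJR f n qn lo A₀ j r z.2.1 ∧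
          (cand n j f).fam z.1 (advJR f n qn lo κA A j r z.1 z.2.1 z.2.2) = (cand n j f).fam z.1 (targetJR f n qn lo A₀ j r z.2.1)).card : ℝ)) /
        (Fintype.card (Dv n) : ℝ) := by
    rw [le_div_iff₀ hD0, ← Finset.sum_congr rfl fun r _ => congrArg (fun k : ℕ => (k : ℝ)) (h7 r)]
    exact_mod_cast h6
  rw [h1, div_le_iff₀ (by positivity)]
  calc ∑ ρ : List.Vector Bool qn, ∑ ys : List.Vector Bool KC.len, ∑ ω : (List.Vector Bool κA), IS ρ ys ω ≤ C₀ := h3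
    _ ≤ _ := h4R
    _ ≤ (∑ r : Fin (R n + 1), (((univ : Finset (Dv n × CoinsJR n qn lo × (List.Vector Bool κA))).filter fun z =>
        advJR f n qn lo κA A j r z.1 z.2.1 z.2.2 ≠ targetJR f n qn lo A₀ j r z.2.1 ∧
          (cand n j f).fam z.1 (advJR f n qn lo κA A j r z.1 z.2.1 z.2.2) = (cand n j f).fam z.1 (targetJR f n qn lo A₀ j r z.2.1)).card : ℝ)) /
        (Fintype.card (Dv n) : ℝ) / (Fintype.card Yv : ℝ) := div_le_div_of_nonneg_right h6R hY0.le
    _ = _ := by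
        have hK0 : (Fintype.card Keys : ℝ) ≠ 0 := by positivity
        have hP0 : (Fintype.card (List.Vector Bool qn × List.Vector Bool lo) : ℝ) ≠ 0 := by positivity
        have hW0 : (Fintype.card (List.Vector Bool κA) : ℝ) ≠ 0 := by positivity
        have hY0' := hY0.ne'
        have hD0' := hD0.ne'
        have halg : ∀ c : ℝ, c / (Fintype.card (Dv n) : ℝ) / (Fintype.card Yv : ℝ) =
            c / ((Fintype.card (Dv n) : ℝ) * ((Fintype.card Yv : ℝ) * ((Fintype.card Keys : ℝ) *
              Fintype.card (List.Vector Bool qn × List.Vector Bool lo))) * Fintype.card (List.Vector Bool κA)) *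
              ((Fintype.card Keys : ℝ) * Fintype.card (List.Vector Bool qn × List.Vector Bool lo) * Fintype.card (List.Vector Bool κA)) := by
          intro c; field_simp
        rw [hZ, hcardC, Finset.sum_div, Finset.sum_div, Finset.sum_mul]
        exact Finset.sum_congr rfl fun r _ => halg _

end Bridge

end HHRVW

end Literature.Computability.Cryptography
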